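import Summits.QuantumFields.BalabanUV.T4Continuum.Support.BlockAverageLoopLogCore
import Literature.MathematicalPhysics.QuantumFieldTheory.Balaban1983to89.T4AveragingDeficitWall
import Literature.Analysis.Complex.RungeUnits

/-!
# T⁴ programme, node NE3 — the kinematic refinement lemma, leaf R1e (file 3/3): THE MISMATCH LAW OF BAŁABAN'S
# AVERAGE (42) and the dictionary to the tree's `flux` ∕ `covGrad` for `U(N)`-valued configurations

NE3 formalisation swarm of the cell `pub-balaban`, crew seat `b2b-balaban-t4-ne3-formalise-leaf-08` (row S4e of
`t4/formal/NE3/LEAVES.md`; owner skeleton `t4/b2b-balaban-t4-ne3-p1/SKELETON-NE3-P1.md` v1.1, §3 leaf R1e «loop-log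
prediction … by non-abelian Stokes over loops of area ≤ dL²»).

CONTEXT.  The owner's re-cut of the refinement hypothesis (H2) of NE3(A) (`Support/MinimalActionRefine`, shape
`SmoothRefine`) asks for a KINEMATIC lemma: a slowly varying small field on the `η`-lattice is the exact block average
(42) of a slowly varying small field on the `η/L`-lattice.  Its plan (skeleton §2 ¶3): R1 an approximate covariant
refinement whose straight-line transporters are PRE-COMPENSATED by the first moment of the loop fluxes of (42), then R2
an exact chain-end correction (`Support/ChainEndContraction`, leaf R2a, in the tree).

THIS FILE (3/3) = the END of row S4e, on top of file 2's loop-log prediction `BlockAverageLoopLogCore.norm_Xavg_sub_Xfirst_le`: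
 * `norm_Xfirst_le` (`‖X¹_c‖ ≤ dL²a`) and **`norm_bavg_sub_exp_Xfirst_mul_le` — THE MISMATCH LAW**: under the hypotheses
   of the loop-log prediction, `‖V̄_c − exp(X¹_c)·V(Γ_c)‖ ≤ 2·(20 d L² θ² + d(d+1)L³ g)` (`V̄_c = bavg L V q κ` (42),
   `V(Γ_c) = hol V q (seg κ L)`, `θ = 8(d+1)(d+4)L²a`; `‖e^X − e^Y‖ ≤ ‖X − Y‖e^{max}` is the tree's
   `Literature.Analysis.Complex.norm_exp_sub_exp_le`) — a fine configuration whose straight-line transporters are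
   PRE-COMPENSATED, `V(Γ_c) = exp(−X¹_c)·U(c)`, averages to `U` up to that error;
 * §5 the DICTIONARY to the tree's flux vocabulary (`T4AveragingDeficitWall.flux`∕`covGrad`, ordered planes `μ < ν`):
   `plaqLog V κ m x = flux V (x; m<κ)` (`rfl`) and `= −flux V (x; κ<m)` (`hol_plaqWord_swap`, `mlog_units_inv`), `= 0` for
   `m = κ`; hence a pointwise bound `‖covGrad V (flux V) x μ π‖ ≤ g` on all planes gives the loop-oriented covariant-step
   hypothesis of file 2 (`covStep_plaqLog_le`);
 * **`loopLog_of_regular`** — THE LAW FOR `U(N)`-VALUED CONFIGURATIONS WITH SUP-FORM REGULARITY DATA (`IsUnitaryCfg`,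
   `SmallField V a`, pointwise `covGrad (flux V) ≤ g` — the three analytic fields of the NE3 lineage's `RegularSup`,
   taken as separate hypotheses so that nothing pending is imported — plus B7's smallness `512(d+1)(d+4)L²a ≤ 1`): both
   laws at every bond of the `L`-lattice.  USE (row R0 ∕ rows S4c–S4d of `t4/formal/NE3/LEAVES.md`): for a level-`(j+1)`
   configuration of data `(b₁η′², c₁η′³)`, `η′ = L^{−(j+1)}`, the mismatch is `≤ (2560·d(d+1)²(d+4)²L³b₁²·η′ +
   2d(d+1)c₁)·η³ ≤ (2560·d(d+1)²(d+4)²L²b₁² + 2d(d+1)c₁)·η³` with `η = L^{−j}` (v1.1: powers of `L` corrected; v1 printed a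
   weaker `L⁶` reading) — the `(m₁c + m₂b²)(L^j)^{−3}` of the skeleton's leaf R1, for ANY construction
   with those data, composing with the owner's R2 (`ChainEndContraction.exists_chainEnd_fixedPoint`, mismatch `δ`).

HONEST FRAMING.  Kinematics of (42) (finite-T⁴ rung (B)+1 of the cell's ladder); OURS and elementary; nothing here is an
estimate on a minimiser; no conditional of the cell (`BetaPertH`, (B), (B^μ)) is used or hidden; nothing bears on
infinite volume, a mass gap, or the Clay problem; **NE3 is NOT proved** (leaf R1e of the UNPROVED kinematic lemma
`SmoothRefine`; leaves R1a–d and the glue R0 remain open).  ABSOLUTE RULE of the cell kept: no printed sentence is a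
hypothesis of any declaration; no `def … : Prop` fact; no `sorry`, no axioms beyond Mathlib's.  PLACEMENT (human rule
2026-08-19): cell work under `Summits/QuantumFields/BalabanUV/`; imports file 2, the tree's Literature modules
`T4AveragingDeficitWall` (flux vocabulary) and `Literature.Analysis.Complex.RungeUnits` (`norm_exp_sub_exp_le`);
moves nothing.  Records: `t4/formal/NE3/LEAVES.md` row S4e; CLAIMS.log «CLAIM NE3-S4e» (l.7127) of the cell `pub-balaban`.
VERSIONS.  v1 (p211824).  v1.1 (DOCSTRING-ONLY): the `η`-readings of the error in the module header and in
`loopLog_of_regular` corrected (`L³`∕`L⁰` instead of `L⁶`; XREAD leaf-04 DOCFIX-LOW); no declaration, statement or proof changed.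
-/

set_option autoImplicit false

open scoped BigOperators
open NormedSpace Finset

namespace Summit.QuantumFields.BalabanUV.T4Continuum.BlockAverageLoopLog

open Literature.MathematicalPhysics.QuantumFieldTheory.Balaban1983to89
open B7Prop1Explicit B7Prop2Explicit MatrixLog
open BlockAverageLoopLogPrep BlockAverageLoopLogCore

noncomputable section

variable {d : ℕ}

/-! ## §4 (continued) The size of `X¹_c` and the mismatch law -/

section Core

variable {𝔸 : Type*} [NormedRing 𝔸] [NormOneClass 𝔸] [NormedAlgebra ℂ 𝔸] [CompleteSpace 𝔸]

/-- The smallness `512(d+1)(d+4)L²a ≤ 1` of B7 Prop. 1 forces `a ≤ 1/512`. [folklore] -/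
theorem le_of_smallness {L : ℕ} (hL : 1 ≤ L) {a : ℝ} (ha : 0 ≤ a)
    (hsmall : 512 * (d + 1) * (d + 4) * (L : ℝ) ^ 2 * a ≤ 1) : a ≤ 1 / 512 := by
  have hLr : (1 : ℝ) ≤ L := by exact_mod_cast hL
  have hP : (1 : ℝ) ≤ ((d : ℝ) + 1) * ((d : ℝ) + 4) * (L : ℝ) ^ 2 :=
    one_le_mul_of_one_le_of_one_le (one_le_mul_of_one_le_of_one_le (by linarith [(Nat.cast_nonneg d : (0 : ℝ) ≤ d)])
      (by linarith [(Nat.cast_nonneg d : (0 : ℝ) ≤ d)])) (one_le_pow₀ hLr)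
  have h1 := mul_le_mul_of_nonneg_right hP (by positivity : (0 : ℝ) ≤ 512 * a)
  have h2 : ((d : ℝ) + 1) * ((d : ℝ) + 4) * (L : ℝ) ^ 2 * (512 * a) = 512 * (d + 1) * (d + 4) * (L : ℝ) ^ 2 * a := by
    ring
  linarith

omit [NormOneClass 𝔸] [NormedAlgebra ℂ 𝔸] [CompleteSpace 𝔸] in
/-- Under the small-field bound (44) every plaquette variable met by the loops of a `κ`-bond is within `a` of `1`
(the degenerate word `plaqWord κ κ` has holonomy `1`). [cite: Balaban1985Averaging, (44) p.24] -/
theorem norm_hol_plaqWord_sub_one_le (V : Site d → Fin d → 𝔸ˣ) {a : ℝ} (ha : 0 ≤ a)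
    (h44 : ∀ (x : Site d) (μ ν : Fin d), μ ≠ ν → ‖((hol V x (plaqWord μ ν) : 𝔸ˣ) : 𝔸) - 1‖ ≤ a)
    (κ m : Fin d) (x : Site d) : ‖((hol V x (plaqWord m κ) : 𝔸ˣ) : 𝔸) - 1‖ ≤ a := by
  by_cases hm : m = κ
  · rw [hm, hol_plaqWord_self]; simpa using ha
  · exact h44 x m κ hm

omit [NormOneClass 𝔸] in
/-- `‖X¹_c‖ ≤ d L² a` under (44): each plaquette logarithm is at most `2a` ((26)) and `L(L−1)/2 ≤ L²/2`. [folklore] -/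
theorem norm_Xfirst_le (L : ℕ) (hL : 1 ≤ L) (V : Site d → Fin d → 𝔸ˣ) {a : ℝ} (ha : 0 ≤ a) (ha2 : a ≤ 1 / 2)
    (h44 : ∀ (x : Site d) (μ ν : Fin d), μ ≠ ν → ‖((hol V x (plaqWord μ ν) : 𝔸ˣ) : 𝔸) - 1‖ ≤ a)
    (q : Site d) (κ : Fin d) : ‖Xfirst L V q κ‖ ≤ d * (L : ℝ) ^ 2 * a := by
  have hLr : (1 : ℝ) ≤ L := by exact_mod_cast hL
  unfold Xfirst
  rw [norm_smul, Real.norm_of_nonneg (by nlinarith : (0 : ℝ) ≤ (L : ℝ) * ((L : ℝ) - 1) / 2)]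
  have hs : ‖∑ m : Fin d, plaqLog V κ m q‖ ≤ d * (2 * a) := by
    calc _ ≤ ∑ m : Fin d, ‖plaqLog V κ m q‖ := norm_sum_le _ _
      _ ≤ ∑ _m : Fin d, 2 * a := Finset.sum_le_sum fun m _ =>
          (MatrixLog.norm_mlog_le_two_mul ((norm_hol_plaqWord_sub_one_le V ha h44 κ m q).trans ha2)).trans
            (by linarith [norm_hol_plaqWord_sub_one_le V ha h44 κ m q])
      _ = d * (2 * a) := by rw [Finset.sum_const, Finset.card_univ, Fintype.card_fin, nsmul_eq_mul]
  have hdLa : 0 ≤ (d : ℝ) * L * a := by positivity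
  calc (L : ℝ) * ((L : ℝ) - 1) / 2 * ‖∑ m : Fin d, plaqLog V κ m q‖
      ≤ (L : ℝ) * ((L : ℝ) - 1) / 2 * (d * (2 * a)) := mul_le_mul_of_nonneg_left hs (by nlinarith)
    _ = d * (L : ℝ) ^ 2 * a - d * L * a := by ring
    _ ≤ d * (L : ℝ) ^ 2 * a := by linarith

/-- **THE MISMATCH LAW of the average (42)**: under the hypotheses of `norm_Xavg_sub_Xfirst_le`,
`‖V̄_c − exp(X¹_c) · V(Γ_c)‖ ≤ 2 · (20 d L² θ² + d(d+1)L³ g)`, `V̄_c = bavg L V q κ` the averaged bond variable (42),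
`V(Γ_c) = hol V q (seg κ L)` the straight-line transporter, `θ = 8(d+1)(d+4)L²a` — i.e. a configuration whose
straight-line transporters are PRE-COMPENSATED, `V(Γ_c) = exp(−X¹_c) · U(c)`, averages to `U` up to
`O(L⁴(d+4)⁴ a² + d²L³ g)`.  (`V̄_c = exp(X_c) V(Γ_c)` by definition; `‖e^X − e^Y‖ ≤ ‖X − Y‖ e^{max ‖X‖ ‖Y‖}` with
`‖X_c‖, ‖X¹_c‖ ≤ 4θ ≤ 1/16`; `‖V(Γ_c)‖ ≤ 1`.)  OURS. [folklore] -/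
theorem norm_bavg_sub_exp_Xfirst_mul_le (L : ℕ) (hL : 1 ≤ L) (V : Site d → Fin d → 𝔸ˣ)
    (hV : ∀ x κ, V x κ ∈ U1 𝔸) {a g : ℝ} (ha : 0 ≤ a) (hg : 0 ≤ g)
    (hsmall : 512 * (d + 1) * (d + 4) * (L : ℝ) ^ 2 * a ≤ 1)
    (h44 : ∀ (x : Site d) (μ ν : Fin d), μ ≠ ν → ‖((hol V x (plaqWord μ ν) : 𝔸ˣ) : 𝔸) - 1‖ ≤ a)
    (q : Site d) (κ : Fin d)
    (hgrad : ∀ (x : Site d) (μ m : Fin d),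
      ‖(V x μ : 𝔸) * plaqLog V κ m (x + e μ) * ((V x μ)⁻¹ : 𝔸ˣ) - plaqLog V κ m x‖ ≤ g) :
    ‖((bavg L V q κ : 𝔸ˣ) : 𝔸) - exp (Xfirst L V q κ) * ((hol V q (seg κ L) : 𝔸ˣ) : 𝔸)‖
      ≤ 2 * (20 * d * (L : ℝ) ^ 2 * (8 * (d + 1) * (d + 4) * (L : ℝ) ^ 2 * a) ^ 2
          + d * (d + 1) * (L : ℝ) ^ 3 * g) := by
  have hd : 1 ≤ d := κ.pos
  have hdr : (1 : ℝ) ≤ d := by exact_mod_cast hd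
  have hLr : (1 : ℝ) ≤ L := by exact_mod_cast hL
  obtain ⟨hE, hXn⟩ := norm_Xavg_sub_Xfirst_le L hL V hV ha hg hsmall h44 q κ hgrad
  set θ : ℝ := 8 * (d + 1) * (d + 4) * (L : ℝ) ^ 2 * a with hθdef
  have hθ1 : θ ≤ 1 / 64 := by
    have : 64 * θ = 512 * (d + 1) * (d + 4) * (L : ℝ) ^ 2 * a := by rw [hθdef]; ring
    linarith
  have ha2 : a ≤ 1 / 2 := (le_of_smallness (d := d) hL ha hsmall).trans (by norm_num)
  have hXf : ‖Xfirst L V q κ‖ ≤ 4 * θ := by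
    refine (norm_Xfirst_le L hL V ha ha2 h44 q κ).trans ?_
    have e1 : 4 * θ - d * (L : ℝ) ^ 2 * a = (L : ℝ) ^ 2 * a * (32 * (d + 1) * (d + 4) - d) := by rw [hθdef]; ring
    have e2 : 0 ≤ (L : ℝ) ^ 2 * a * (32 * ((d : ℝ) + 1) * (d + 4) - d) := mul_nonneg (by positivity) (by nlinarith)
    linarith
  -- `e^{max} ≤ 2`
  have hmax : max ‖Xavg L V q κ‖ ‖Xfirst L V q κ‖ ≤ 1 / 2 := max_le (by linarith) (by linarith)
  have hexp : Real.exp (max ‖Xavg L V q κ‖ ‖Xfirst L V q κ‖) ≤ 2 := by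
    set x := max ‖Xavg L V q κ‖ ‖Xfirst L V q κ‖ with hx
    have h1 : 1 - x ≤ Real.exp (-x) := by have := Real.add_one_le_exp (-x); linarith
    have h2 : Real.exp x * (1 - x) ≤ 1 := by
      calc Real.exp x * (1 - x) ≤ Real.exp x * Real.exp (-x) :=
            mul_le_mul_of_nonneg_left h1 (Real.exp_pos x).le
        _ = 1 := by rw [← Real.exp_add, add_neg_cancel, Real.exp_zero]
    nlinarith [Real.exp_pos x]
  have hF : ((bavg L V q κ : 𝔸ˣ) : 𝔸) = exp (Xavg L V q κ) * ((hol V q (seg κ L) : 𝔸ˣ) : 𝔸) := rfl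
  rw [hF, ← sub_mul]
  have hhol : ‖((hol V q (seg κ L) : 𝔸ˣ) : 𝔸)‖ ≤ 1 := (hol_mem hV q _).1
  have hE0 : 0 ≤ ‖Xavg L V q κ - Xfirst L V q κ‖ := norm_nonneg _
  calc ‖(exp (Xavg L V q κ) - exp (Xfirst L V q κ)) * ((hol V q (seg κ L) : 𝔸ˣ) : 𝔸)‖
      ≤ ‖exp (Xavg L V q κ) - exp (Xfirst L V q κ)‖ * ‖((hol V q (seg κ L) : 𝔸ˣ) : 𝔸)‖ := norm_mul_le _ _
    _ ≤ (‖Xavg L V q κ - Xfirst L V q κ‖ * Real.exp (max ‖Xavg L V q κ‖ ‖Xfirst L V q κ‖)) * 1 := by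
        gcongr; exact Literature.Analysis.Complex.norm_exp_sub_exp_le _ _
    _ ≤ (‖Xavg L V q κ - Xfirst L V q κ‖ * 2) * 1 := by gcongr
    _ ≤ _ := by linarith

/-- **THE MISMATCH FROM THE PRE-COMPENSATION DEFECT** (the form consumed by the refinement construction, rows
S4c–S4d ∕ the owner's `ApproxRefine`): for any target `T`, the rescaled average (43) of `V` at the coarse bond `(z, κ)`
misses `T` by at most `2·(20 d L² θ² + d(d+1)L³ g) + 2·‖V(Γ_c) − exp(−X¹_c)·T‖`, `c = ⟨Lz, Lz + Le_κ⟩` — so a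
configuration whose straight-line transporters are `exp(−X¹_c)·T` EXACTLY averages to `T` up to the first term.
(`V̄_c − T = (V̄_c − e^{X¹}V(Γ_c)) + e^{X¹}(V(Γ_c) − e^{−X¹}T)`, `‖e^{X¹}‖ ≤ e^{dL²a} ≤ 2`.) OURS. [folklore] -/
theorem norm_rescale_bavg_sub_le (L : ℕ) (hL : 1 ≤ L) (V : Site d → Fin d → 𝔸ˣ)
    (hV : ∀ x κ, V x κ ∈ U1 𝔸) {a g : ℝ} (ha : 0 ≤ a) (hg : 0 ≤ g)
    (hsmall : 512 * (d + 1) * (d + 4) * (L : ℝ) ^ 2 * a ≤ 1)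
    (h44 : ∀ (x : Site d) (μ ν : Fin d), μ ≠ ν → ‖((hol V x (plaqWord μ ν) : 𝔸ˣ) : 𝔸) - 1‖ ≤ a)
    (z : Site d) (κ : Fin d)
    (hgrad : ∀ (x : Site d) (μ m : Fin d),
      ‖(V x μ : 𝔸) * plaqLog V κ m (x + e μ) * ((V x μ)⁻¹ : 𝔸ˣ) - plaqLog V κ m x‖ ≤ g) (T : 𝔸) :
    ‖((rescale L (bavg L V) z κ : 𝔸ˣ) : 𝔸) - T‖
      ≤ 2 * (20 * d * (L : ℝ) ^ 2 * (8 * (d + 1) * (d + 4) * (L : ℝ) ^ 2 * a) ^ 2 + d * (d + 1) * (L : ℝ) ^ 3 * g)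
        + 2 * ‖((hol V ((L : ℤ) • z) (seg κ L) : 𝔸ˣ) : 𝔸) - exp (-Xfirst L V ((L : ℤ) • z) κ) * T‖ := by
  set q : Site d := (L : ℤ) • z with hq
  have hd : 1 ≤ d := κ.pos
  have hdr : (1 : ℝ) ≤ d := by exact_mod_cast hd
  have hLr : (1 : ℝ) ≤ L := by exact_mod_cast hL
  have hE := norm_bavg_sub_exp_Xfirst_mul_le L hL V hV ha hg hsmall h44 q κ hgrad
  have ha2 : a ≤ 1 / 2 := (le_of_smallness (d := d) hL ha hsmall).trans (by norm_num)
  have hXf : ‖Xfirst L V q κ‖ ≤ 1 / 2 := by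
    refine (norm_Xfirst_le L hL V ha ha2 h44 q κ).trans ?_
    have h1 : d * (L : ℝ) ^ 2 * a ≤ 8 * (d + 1) * (d + 4) * (L : ℝ) ^ 2 * a := by
      have : 0 ≤ (L : ℝ) ^ 2 * a * (8 * ((d : ℝ) + 1) * (d + 4) - d) := mul_nonneg (by positivity) (by nlinarith)
      nlinarith
    have h2 : 8 * (d + 1) * (d + 4) * (L : ℝ) ^ 2 * a ≤ 1 / 64 := by linarith
    linarith
  have hexpY : ‖exp (Xfirst L V q κ)‖ ≤ 2 := by
    have h1 := B7Transfer.norm_exp_sub_one_le_of_le (Xfirst L V q κ) hXf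
    have h2 : ‖exp (Xfirst L V q κ)‖ ≤ ‖exp (Xfirst L V q κ) - 1‖ + ‖(1 : 𝔸)‖ := by
      have := norm_add_le (exp (Xfirst L V q κ) - 1) (1 : 𝔸); rwa [sub_add_cancel] at this
    have h3 : Real.exp (1 / 2 : ℝ) ≤ 2 := by
      have h4 : (1 : ℝ) - 1 / 2 ≤ Real.exp (-(1 / 2 : ℝ)) := by have := Real.add_one_le_exp (-(1 / 2 : ℝ)); linarith
      have h5 : Real.exp (1 / 2 : ℝ) * Real.exp (-(1 / 2 : ℝ)) = 1 := by rw [← Real.exp_add, add_neg_cancel, Real.exp_zero]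
      nlinarith [Real.exp_pos (1 / 2 : ℝ), Real.exp_pos (-(1 / 2 : ℝ))]
    rw [norm_one] at h2
    linarith
  have hE1 : exp (Xfirst L V q κ) * exp (-Xfirst L V q κ) = 1 := by
    have := (expUnit (Xfirst L V q κ)).val_inv
    simpa [val_inv_expUnit] using this
  have hid : ((rescale L (bavg L V) z κ : 𝔸ˣ) : 𝔸) - T
      = (((bavg L V q κ : 𝔸ˣ) : 𝔸) - exp (Xfirst L V q κ) * ((hol V q (seg κ L) : 𝔸ˣ) : 𝔸))
        + exp (Xfirst L V q κ) * (((hol V q (seg κ L) : 𝔸ˣ) : 𝔸) - exp (-Xfirst L V q κ) * T) := by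
    rw [rescale_apply, ← hq, mul_sub, ← mul_assoc, hE1, one_mul]; abel
  rw [hid]
  calc _ ≤ ‖((bavg L V q κ : 𝔸ˣ) : 𝔸) - exp (Xfirst L V q κ) * ((hol V q (seg κ L) : 𝔸ˣ) : 𝔸)‖
        + ‖exp (Xfirst L V q κ) * (((hol V q (seg κ L) : 𝔸ˣ) : 𝔸) - exp (-Xfirst L V q κ) * T)‖ := norm_add_le _ _
    _ ≤ _ + ‖exp (Xfirst L V q κ)‖ * ‖((hol V q (seg κ L) : 𝔸ˣ) : 𝔸) - exp (-Xfirst L V q κ) * T‖ :=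
        add_le_add hE (norm_mul_le _ _)
    _ ≤ _ := by gcongr

end Core

/-! ## §5 The dictionary to the tree's `flux` ∕ `covGrad` (planes `μ < ν`) and the law for `U(N)`-valued
configurations with sup-form regularity data -/

section Dictionary

variable {𝔸 : Type*} [NormedRing 𝔸] [NormOneClass 𝔸] [NormedAlgebra ℂ 𝔸] [CompleteSpace 𝔸]

omit [NormOneClass 𝔸] [NormedAlgebra ℂ 𝔸] [CompleteSpace 𝔸] in
/-- Reversing the orientation of a plaquette word inverts its holonomy: `V(∂p; m, κ) = V(∂p; κ, m)⁻¹`. [folklore] -/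
theorem hol_plaqWord_swap (V : Site d → Fin d → 𝔸ˣ) (x : Site d) (m κ : Fin d) :
    hol V x (plaqWord m κ) = (hol V x (plaqWord κ m))⁻¹ := by
  simp only [plaqWord, hol_cons, hol_nil, mul_one, stepHol_true, stepHol_false, Letter.vec_true,
    Letter.vec_false, mul_inv_rev, inv_inv]
  rw [show x + e m + e κ - e m = x + e κ by abel, show x + e κ + e m - e κ = x + e m by abel,
    show x + e m + e κ + -e m - e κ = x by abel, show x + e κ + e m + -e κ - e m = x by abel]
  simp only [mul_assoc]

omit [NormOneClass 𝔸] in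
/-- `log W⁻¹ = −log W` for a unit `W` with `‖W − 1‖ ≤ 1/4` (`W⁻¹ = exp(−log W)` and the tree's `mlog_exp` on the
ball `‖·‖ < log 2`). [cite: Balaban1985Averaging, (21)–(27) p.21] -/
theorem mlog_units_inv {W : 𝔸ˣ} (hW : ‖(W : 𝔸) - 1‖ ≤ 1 / 4) :
    mlog (((W⁻¹ : 𝔸ˣ) : 𝔸)) = -mlog (W : 𝔸) := by
  have hW1 : ‖(W : 𝔸) - 1‖ < 1 := by linarith
  rw [units_val_inv_eq_exp_neg (MatrixLog.exp_mlog hW1).symm]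
  refine B7BlockAvgLog.mlog_exp ?_
  rw [norm_neg]
  have h1 := MatrixLog.norm_mlog_le_two_mul (show ‖(W : 𝔸) - 1‖ ≤ 1 / 2 by linarith)
  have h2 := Real.log_two_gt_d9
  linarith

end Dictionary

section Unitary

open scoped Matrix.Norms.L2Operator
open T4AveragingDeficitWall (Plane flux covGrad Ad IsUnitaryCfg SmallField fhol)

variable {n : Type*} [Fintype n] [DecidableEq n] [Nonempty n]

omit [Nonempty n] in
/-- For `m < κ` the loop-oriented plaquette logarithm IS the tree's flux of the plane `(m, κ)`. [folklore] -/
theorem plaqLog_eq_flux (V : Site d → Fin d → (Matrix n n ℂ)ˣ) {κ m : Fin d} (h : m < κ) (x : Site d) :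
    plaqLog V κ m x = flux V (x, ⟨(m, κ), h⟩) := rfl

omit [Nonempty n] in
/-- For `κ < m` the loop-oriented plaquette logarithm is MINUS the tree's flux of the plane `(κ, m)` (inside the
small-field class, `‖V(∂p) − 1‖ ≤ 1/4`). [folklore] -/
theorem plaqLog_eq_neg_flux (V : Site d → Fin d → (Matrix n n ℂ)ˣ) {κ m : Fin d} (h : κ < m) (x : Site d)
    (hx : ‖((hol V x (plaqWord κ m) : (Matrix n n ℂ)ˣ) : Matrix n n ℂ) - 1‖ ≤ 1 / 4) :
    plaqLog V κ m x = -flux V (x, ⟨(κ, m), h⟩) := by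
  unfold plaqLog flux fhol
  rw [hol_plaqWord_swap, mlog_units_inv hx]

omit [Nonempty n] in
/-- The plaquette logarithm of the degenerate word `plaqWord κ κ` vanishes. [folklore] -/
theorem plaqLog_self (V : Site d → Fin d → (Matrix n n ℂ)ˣ) (κ : Fin d) (x : Site d) : plaqLog V κ κ x = 0 := by
  unfold plaqLog; rw [hol_plaqWord_self]; simp

omit [Nonempty n] in
/-- **The covariant-gradient hypothesis of the core law from the tree's `covGrad (flux V)`**: a pointwise bound
`‖(∇_V F)(x, μ; π)‖ ≤ g` on all ordered planes gives the loop-oriented bound for every `m` (sign-insensitive; the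
degenerate `m = κ` term is `0`). [folklore] -/
theorem covStep_plaqLog_le (V : Site d → Fin d → (Matrix n n ℂ)ˣ) {a g : ℝ} (hg : 0 ≤ g) (ha4 : a ≤ 1 / 4)
    (hSF : SmallField V a) (hgrad : ∀ (x : Site d) (μ : Fin d) (π : Plane d), ‖covGrad V (flux V) x μ π‖ ≤ g)
    (κ : Fin d) (x : Site d) (μ m : Fin d) :
    ‖(V x μ : Matrix n n ℂ) * plaqLog V κ m (x + e μ) * ((V x μ)⁻¹ : (Matrix n n ℂ)ˣ) - plaqLog V κ m x‖ ≤ g := by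
  rcases lt_trichotomy m κ with h | h | h
  · rw [plaqLog_eq_flux V h, plaqLog_eq_flux V h]
    exact hgrad x μ ⟨(m, κ), h⟩
  · subst h
    rw [plaqLog_self, plaqLog_self, mul_zero, zero_mul, sub_zero, norm_zero]
    exact hg
  · rw [plaqLog_eq_neg_flux V h _ ((hSF _ κ m h.ne).trans ha4),
      plaqLog_eq_neg_flux V h _ ((hSF _ κ m h.ne).trans ha4)]
    have key : (V x μ : Matrix n n ℂ) * -flux V (x + e μ, ⟨(κ, m), h⟩) * ((V x μ)⁻¹ : (Matrix n n ℂ)ˣ)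
        - -flux V (x, ⟨(κ, m), h⟩)
        = -((V x μ : Matrix n n ℂ) * flux V (x + e μ, ⟨(κ, m), h⟩) * ((V x μ)⁻¹ : (Matrix n n ℂ)ˣ)
            - flux V (x, ⟨(κ, m), h⟩)) := by noncomm_ring
    rw [key, norm_neg]
    exact hgrad x μ ⟨(κ, m), h⟩

/-- **THE LOOP-LOG PREDICTION AND THE MISMATCH LAW FOR `U(N)`-VALUED CONFIGURATIONS WITH SUP-FORM REGULARITY DATA**
(the hypotheses are the three analytic fields of the NE3 lineage's `RegularSup`: `U(N)`-valued, small field of radius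
`a`, pointwise covariant flux gradient `≤ g`; plus B7's smallness `512(d+1)(d+4)L²a ≤ 1`): for every bond
`c = ⟨q, q + Le_κ⟩` of the `L`-lattice, with `θ = 8(d+1)(d+4)L²a`,
`‖X_c − X¹_c‖ ≤ 20 d L² θ² + d(d+1)L³ g` and `‖V̄_c − exp(X¹_c) V(Γ_c)‖ ≤ 2(20 d L² θ² + d(d+1)L³ g)`.
For the NE3 kinematic lemma (owner skeleton leaf R1e): a fine configuration of sup-form data `(b₁η′², c₁η′³)`,
`η′ = L^{−(j+1)}`, whose straight-line transporters are pre-compensated by `exp(−X¹_c)`, averages to its target up to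
`(2560 d (d+1)²(d+4)² L³ b₁² η′ + 2 d (d+1) c₁) · η³ ≤ (2560 d(d+1)²(d+4)²L² b₁² + 2d(d+1) c₁) · η³`, `η = L^{−j}`
(j-uniform; v1.1 docstring: powers of `L` corrected, the v1 text printed a weaker `L⁶` reading — XREAD leaf-04, CLAIMS.log
«XREAD VERDICT p211824»).  NE3 is NOT proved by this file (leaves
R1a–d, R0 of the kinematic lemma remain; R2 is the owner's `ChainEndContraction`). OURS. [folklore] -/
theorem loopLog_of_regular (L : ℕ) (hL : 1 ≤ L) (V : Site d → Fin d → (Matrix n n ℂ)ˣ) (hU : IsUnitaryCfg V)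
    {a g : ℝ} (ha : 0 ≤ a) (hg : 0 ≤ g) (hsmall : 512 * (d + 1) * (d + 4) * (L : ℝ) ^ 2 * a ≤ 1)
    (hSF : SmallField V a) (hgrad : ∀ (x : Site d) (μ : Fin d) (π : Plane d), ‖covGrad V (flux V) x μ π‖ ≤ g)
    (q : Site d) (κ : Fin d) :
    ‖Xavg L V q κ - Xfirst L V q κ‖
        ≤ 20 * d * (L : ℝ) ^ 2 * (8 * (d + 1) * (d + 4) * (L : ℝ) ^ 2 * a) ^ 2 + d * (d + 1) * (L : ℝ) ^ 3 * g ∧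
      ‖((bavg L V q κ : (Matrix n n ℂ)ˣ) : Matrix n n ℂ) - exp (Xfirst L V q κ) * ((hol V q (seg κ L) :
          (Matrix n n ℂ)ˣ) : Matrix n n ℂ)‖
        ≤ 2 * (20 * d * (L : ℝ) ^ 2 * (8 * (d + 1) * (d + 4) * (L : ℝ) ^ 2 * a) ^ 2
            + d * (d + 1) * (L : ℝ) ^ 3 * g) := by
  letI : CStarAlgebra (Matrix n n ℂ) := {}
  have hV : ∀ x μ, V x μ ∈ U1 (Matrix n n ℂ) := fun x μ => unitaryUnits_le_U1 (hU x μ)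
  have ha4 : a ≤ 1 / 4 := (le_of_smallness (d := d) hL ha hsmall).trans (by norm_num)
  have hcov := covStep_plaqLog_le V hg ha4 hSF hgrad κ
  exact ⟨(norm_Xavg_sub_Xfirst_le L hL V hV ha hg hsmall hSF q κ hcov).1,
    norm_bavg_sub_exp_Xfirst_mul_le L hL V hV ha hg hsmall hSF q κ hcov⟩

/-- **The mismatch from the pre-compensation defect, for `U(N)`-valued configurations with sup-form regularity data**
(`loopLog_of_regular` ∘ `norm_rescale_bavg_sub_le`): for any target `T` at the coarse bond `(z, κ)`,
`‖rescale L (bavg L V) z κ − T‖ ≤ 2·(20 d L² θ² + d(d+1)L³ g) + 2·‖V(Γ_c) − exp(−X¹_c)·T‖`. OURS. [folklore] -/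
theorem mismatch_of_regular (L : ℕ) (hL : 1 ≤ L) (V : Site d → Fin d → (Matrix n n ℂ)ˣ) (hU : IsUnitaryCfg V)
    {a g : ℝ} (ha : 0 ≤ a) (hg : 0 ≤ g) (hsmall : 512 * (d + 1) * (d + 4) * (L : ℝ) ^ 2 * a ≤ 1)
    (hSF : SmallField V a) (hgrad : ∀ (x : Site d) (μ : Fin d) (π : Plane d), ‖covGrad V (flux V) x μ π‖ ≤ g)
    (z : Site d) (κ : Fin d) (T : Matrix n n ℂ) :
    ‖((rescale L (bavg L V) z κ : (Matrix n n ℂ)ˣ) : Matrix n n ℂ) - T‖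
      ≤ 2 * (20 * d * (L : ℝ) ^ 2 * (8 * (d + 1) * (d + 4) * (L : ℝ) ^ 2 * a) ^ 2 + d * (d + 1) * (L : ℝ) ^ 3 * g)
        + 2 * ‖((hol V ((L : ℤ) • z) (seg κ L) : (Matrix n n ℂ)ˣ) : Matrix n n ℂ)
            - exp (-Xfirst L V ((L : ℤ) • z) κ) * T‖ := by
  letI : CStarAlgebra (Matrix n n ℂ) := {}
  have hV : ∀ x μ, V x μ ∈ U1 (Matrix n n ℂ) := fun x μ => unitaryUnits_le_U1 (hU x μ)
  have ha4 : a ≤ 1 / 4 := (le_of_smallness (d := d) hL ha hsmall).trans (by norm_num)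
  exact norm_rescale_bavg_sub_le L hL V hV ha hg hsmall hSF z κ (covStep_plaqLog_le V hg ha4 hSF hgrad κ) T

end Unitary

end

end Summit.QuantumFields.BalabanUV.T4Continuum.BlockAverageLoopLog
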